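import Summits.RiemannHypothesis.RiemannHypothesis.Theorems.GroundBartaPolarPerronFrobeniusSignImprovingBarrierEven
import HarnessLib

/-!
# RiemannHypothesis / GroundBarta — crux `PolarPerronFrobenius` (stmt-RiemannHypothesis-18390):
# the even-sector barrier from `a ≥ 33/100` (sharpness of the `a ≤ 1/4` theorem)

Helper file (`--supports stmt-RiemannHypothesis-18390`), RH-free, Mathlib + proved tree files only,
no definitions, no named facts.

The even-sector sign-improving theorem (`…EvenSmallWindows.lean`: even cone density and `GSP a` for
`0 < a ≤ 1/4`) rests on the symmetrised kernel inequality, whose exact threshold is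
`w(a) = 2cosh(a/2)`, `a = 0.2812…`.  The parametric even barrier `sw_even_not_signImproving`
(`…SignImprovingBarrierEven.lean`, there instantiated only at `a ≥ 11/20`) shows the mechanism is dead
beyond it; here it is instantiated at `α = 3/10`, `β = 17/50`:

* `swe_weilArchDensity_three_tenths_lt_two`: `w(3/10) < 2` (`< 2cosh(3/20)`);
* `swe_even_not_signImproving_of_ge`: **for every window `a ≥ 33/100` there is an EVEN real window test
  `f = p − q` with `|f| = p + q` a test and `Re Q(|f|) > Re Q(f)`.**

So `f ↦ |f|` improves the energy of every even real test for `a ≤ 1/4` and fails to for `a ≥ 33/100`;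
beyond, even cone density needs the structure of near-minimisers (source criterion,
`…SourceCriterion.lean`).

Prover B, speedrun unit `sr-gb-rung-b` (seat 2).
-/

set_option linter.dupNamespace false

noncomputable section

open Set MeasureTheory Filter Complex
open scoped Real Topology

namespace Summit.RiemannHypothesis.RiemannHypothesis.Theorems.PolarPerronFrobenius

open Literature.NumberTheory.LFunctions

/-- `w(3/10) < 2`: with `u = e^{3/20} ≥ 1.16`, `w(3/10) = u/(2(u² − u⁻²)) < 2 ⟺ u³ < 4u⁴ − 4`,
and `4u⁴ − u³ − 4 > 0` for `u ≥ 1.16`. [folklore] -/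
theorem swe_weilArchDensity_three_tenths_lt_two : weilArchDensity (3 / 10) < 2 := by
  have hu : (1.16 : ℝ) ≤ Real.exp (3 / 20) := by
    have h : (1 : ℝ) + 3 / 20 + (3 / 20) ^ 2 / 2 ≤ Real.exp (3 / 20) :=
      Real.quadratic_le_exp_of_nonneg (by norm_num)
    linarith
  have hupos : 0 < Real.exp (3 / 20) := Real.exp_pos _
  set u : ℝ := Real.exp (3 / 20) with hudef
  have hu4 : (1.81 : ℝ) ≤ u ^ 4 := le_trans (by norm_num) (pow_le_pow_left₀ (by norm_num) hu 4)
  have hu4' : 0 < u ^ 4 - 1 := by linarith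
  have hs : 2 * Real.sinh (3 / 10) = (u ^ 4 - 1) / u ^ 2 := by
    rw [Real.sinh_eq]
    have e1 : Real.exp (3 / 10) = u ^ 2 := by
      rw [hudef, ← Real.exp_nat_mul]; norm_num
    have e2 : Real.exp (-(3 / 10)) = (u ^ 2)⁻¹ := by
      rw [← e1, ← Real.exp_neg]
    rw [e1, e2]
    field_simp
  have hnum : weilArchDensity (3 / 10) = u ^ 3 / (u ^ 4 - 1) := by
    unfold weilArchDensity
    rw [hs, show (3 : ℝ) / 10 / 2 = 3 / 20 by norm_num, ← hudef]
    rw [div_div_eq_mul_div]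
    field_simp
  rw [hnum, div_lt_iff₀ hu4']
  nlinarith [hu, pow_le_pow_left₀ (by norm_num) hu 2, pow_le_pow_left₀ (by norm_num) hu 3, hu4]

/-- **Even barrier at every window `a ≥ 33/100`.**  For every `a ≥ 33/100` there is an EVEN real
window test `f = p − q` on `[-a, a]` (even bump at `0` minus the symmetrised bump at `±8/25`, disjoint
supports, so `|f| = p + q` is again an even test) with `Re Q(|f|) > Re Q(f)`.  Together with
`swe_evenConeDense` (`a ≤ 1/4`): the Beurling–Deny map `f ↦ |f|` settles even cone density exactly on
the small windows (threshold `0.2812…` in between). [folklore] -/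
theorem swe_even_not_signImproving_of_ge {a : ℝ} (ha : 33 / 100 ≤ a) :
    ∃ p q : ℝ → ℝ, IsWeilTest (fun t ↦ ((p t : ℝ) : ℂ)) ∧ IsWeilTest (fun t ↦ ((q t : ℝ) : ℂ)) ∧
      tsupport p ⊆ Icc (-a) a ∧ tsupport q ⊆ Icc (-a) a ∧ (∀ t, p (-t) = p t) ∧ (∀ t, q (-t) = q t) ∧
      (∀ t, 0 ≤ p t) ∧ (∀ t, 0 ≤ q t) ∧ (∀ t, p t * q t = 0) ∧ (∀ t, |p t - q t| = p t + q t) ∧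
      (∃ t, 0 < p t) ∧ (∃ t, 0 < q t) ∧
      (weilQuadratic (fun t ↦ ((p t - q t : ℝ) : ℂ))).re <
        (weilQuadratic (fun t ↦ ((p t + q t : ℝ) : ℂ))).re := by
  have hlog : (17 / 50 : ℝ) < Real.log 2 := by
    have := Real.log_two_gt_d9; linarith
  have hthr : weilArchDensity (3 / 10) < 2 * Real.cosh ((3 / 10) / 2) := by
    have h1 := swe_weilArchDensity_three_tenths_lt_two
    have h2 : 1 ≤ Real.cosh ((3 / 10) / 2) := Real.one_le_cosh _
    linarith
  exact sw_even_not_signImproving (α := 3 / 10) (β := 17 / 50) (by norm_num) (by norm_num) hlog hthr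
    (by linarith)

end Summit.RiemannHypothesis.RiemannHypothesis.Theorems.PolarPerronFrobenius

end
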